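import Summits.BirchSwinnertonDyer.BirchSwinnertonDyer.Theorems.EisensteinPrimesGoodLatticeKatzMeasureRigidityUnitValues
import Summits.BirchSwinnertonDyer.BirchSwinnertonDyer.Theorems.PrintCf2RubinValueTwoKatzPeriodNormRigidity
import Summits.BirchSwinnertonDyer.BirchSwinnertonDyer.Theorems.PrintCf2RubinValueTwoGoodTwistDictPairSigns
import HarnessLib

set_option linter.dupNamespace false
set_option autoImplicit false

/-!
# THE PERIOD-RIGIDITY UNIT AT EVERY ALGEBRAIC POINT, and TRANSPORT OF THE REFLECTED FRAME `λ̌` OF de Shalit II.6.4 TO A SECOND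
# PERIOD TRIPLE on every genuine interpolation pair (every imaginary quadratic `K`, every split `p`)

Cell `bsd-eis`, width seat `bsd-line-x1-p1-w2` gen 32; `--supports stmt-BirchSwinnertonDyer-19032` (crux 2 `GoodLatticeBDPValue`, line
`halves` v34N; helper, closes nothing).  File 5 of the thmII64 certificates.  THEOREMS ONLY (no `def`, no named fact, no `sorry`).

Setting: `G ≠ 0`, `G'` frames of ONE branch `λ` (type `(k, j)`, unramified off `S ∪ {v̄}`) at two period triples, `U` the unit with
`G' = U·G` (file 3), `A = ι⁻¹(Ω/Ω')·Ω_p'/Ω_p`, `B = ι⁻¹(δ/δ')`.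
* §4 `hasValueAt₂_rigidityUnit_at_algebraic` — **at the point of EVERY algebraic Hecke character `ρ` of type `(α, β)` with avatar
  through the pair and unramified off `v̄`, `U` takes the value `A^{(j−k)+(β−α)}·B^{j+β}`** (integer exponents): one listing twist `η`
  lists `λη`, `λη²`, `λρη`; file 4 §2 at the three twists; multiplicativity of the twisted-unit values twice.  The period ratio
  between two normalisations IS the predicted character on every genuine interpolation point of BOTH branches `λ`, `λ̌`.
* §5 `norm_periodRatio_eq_one_of_hasInfinityType` — `‖A‖ = ‖B‖ = 1` for a branch of any integer type (by twisting).
* §6 `reflectFrame_transport_on_unramified` — **TRANSPORT OF THE `λ̌`-FRAME**: with `Ǧ` a `λ̌`-frame (`λ̌ = reflect λ` at `c • S`) at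
  `(Ω, δ, Ω_p)` and `κ₀ = B^{−(k+j+1)}` (norm one), the series `Ǧ' := C(C κ₀)·U·Ǧ` satisfies the interpolation property of the
  `λ̌`-frame AT `(Ω', δ', Ω_p')` at every interpolation pair `(ρ', r')` whose character `ρ'` is unramified at every `w ≠ v̄`.  Every GENUINE
  pair is such (an avatar through the tower is unramified away from `p`, and so is its character); the frame predicate's weak avatar
  notion `IsPAdicAvatarOf` (which constrains `r'` only where `ρ'` is unramified) does not record it, so the hypothesis is displayed.

UPSHOT for the typed `DeShalit1987.thmII64_katzMeasure₂_functionalEquation` (crux 2's 7th by-name input): its ∀-period phrasing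
claims beyond print a `λ̌`-frame (and the relation) at a non-admissible triple carrying a `λ`-frame; §6 builds that frame on all
genuine pairs.  Left for the FULL period-axis certificate: (i) discharge the displayed hypothesis by the tree's avatar rigidity
(`IsPAdicAvatarOf.eq_weilRep`, `isPAdicAvatarOf_unique`); (ii) transport the RELATION through `U` (`U(P r)/U(P r₂)` is a character of
`r` by §4; needs a `g' ∈ Γ_K` with prescribed pair coordinates).  HONEST FRAMING: helper theorems; nothing here proves a summit
statement, the crux, a stub, BSD, or a theorem of de Shalit / Katz / Rubin; 0 cells / labels / tiers move.

References: [deShalit1987] II.4.12 Rem. (iii)–(iv), II.4.16–17, II.6.1 (1), II.6.4 (p. 85); [Gouvea1993PadicNumbers] §5.9.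
-/

noncomputable section

open scoped NumberField Classical Topology
open Filter NumberField IsDedekindDomain Field
open Literature Literature.NumberTheory.GaloisRepresentations Literature.NumberTheory.EllipticCurves
open Literature.NumberTheory.EllipticCurves.DeShalit1987
open Summit.BirchSwinnertonDyer.Rank1Residual.X11b Summit.BirchSwinnertonDyer.Rank1Residual.X11b.LambdaSupply
open Summit.BirchSwinnertonDyer.Rank1Residual.X11b.Three.LambdaSupply
open Summit.BirchSwinnertonDyer.BirchSwinnertonDyer.Theorems.GoodLatticeKatzMeasureUniqueness
open Summit.BirchSwinnertonDyer.BirchSwinnertonDyer.Theorems.GoodLatticeKatzMeasureUniquenessBinders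
open Summit.BirchSwinnertonDyer.BirchSwinnertonDyer.Theorems.GoodLatticeKatzMeasurePeriodRigidity
open Summit.BirchSwinnertonDyer.BirchSwinnertonDyer.Theorems.GoodLatticeKatzMeasureRigidityUnitValues

namespace Summit.BirchSwinnertonDyer.BirchSwinnertonDyer.Theorems.GoodLatticeKatzMeasureReflectTransport

variable {p : ℕ} [Fact p.Prime] {K : Type} [Field K] [NumberField K]

/-! ### §4 The rigidity unit at the point of ANY algebraic character through the pair unramified off `v̄` -/

/-- **THE RIGIDITY UNIT AT A GENERAL ALGEBRAIC POINT.** `λ` of type `(k, j)` unramified off `S ∪ {v̄}`, topological pair, `G ≠ 0`,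
`G'` frames of `λ` at `(Ω, δ, Ω_p)`, `(Ω', δ', Ω_p')`, `G' = U·G`.  For every algebraic Hecke character `ρ` of type `(α, β)` with a
unit-valued avatar `e ∘ ψ` through the pair, unramified at every `w ≠ v̄`, the unit takes at `(ρ̂(γ₁) − 1, ρ̂(γ₂) − 1)` the value
`A^{(j − k) + (β − α)} · B^{j + β}` (integer exponents; `A = ι⁻¹(Ω/Ω')·Ω_p'/Ω_p`, `B = ι⁻¹(δ/δ')`).  Proof: one listing twist `η` (file 3
§1) for the bound `|k|+|j|+|α|+|β|` lists `λη`, `λη²`, `λρη`; §2 at the three twists and multiplicativity (§1) twice.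
[cite: deShalit1987, II.4.12 Remarks (iii)–(iv) (p. 66–67), II.4.17 (51)–(54) (store chunk 77–78), II.6.4 proof (store chunk 85)] -/
theorem hasValueAt₂_rigidityUnit_at_algebraic (hK : IsImaginaryQuadratic K)
    {ι : PadicAlgCl p ≃+* ℂ} {v vbar : HeightOneSpectrum (𝓞 K)}
    (hv : ((p : ℕ) : 𝓞 K) ∈ v.asIdeal) (hvbar : ((p : ℕ) : 𝓞 K) ∈ vbar.asIdeal) (hne : vbar ≠ v)
    (hι : ∀ (w : InfinitePlace K) (d : 𝓞 K), d ∈ v.asIdeal ↔ ‖ι.symm (w.embedding (d : K))‖ < 1)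
    {S : Finset (HeightOneSpectrum (𝓞 K))} {lam : HeckeCharacter K} {kl jl : ℤ}
    (hlam : lam.HasInfinityType (fun _ ↦ kl) (fun _ ↦ jl))
    (hlamu : ∀ w : HeightOneSpectrum (𝓞 K), w ∉ S → w ≠ vbar → lam.IsUnramifiedAt w)
    {κ₁ κ₂ : ZpExtension K p} {γ₁ γ₂ : absoluteGaloisGroup K}
    (hpair : ZpExtension.IsTopGeneratorPair κ₁ κ₂ γ₁ γ₂)
    {ρ : HeckeCharacter K} {αρ βρ : ℤ} (hρt : ρ.HasInfinityType (fun _ ↦ αρ) (fun _ ↦ βρ))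
    {ψρ : absoluteGaloisGroup K →ₜ* (PadicAlgCl p)ˣ}
    (heρ : IsPAdicAvatarOf ι ρ ((FramedRep.unitsContinuousMulEquivOfUnique (Fin 1) (PadicAlgCl p) :
        (PadicAlgCl p)ˣ →ₜ* GL (Fin 1) (PadicAlgCl p)).comp ψρ))
    (hρκ : FactorsThroughPair κ₁ κ₂ ((FramedRep.unitsContinuousMulEquivOfUnique (Fin 1) (PadicAlgCl p) :
        (PadicAlgCl p)ˣ →ₜ* GL (Fin 1) (PadicAlgCl p)).comp ψρ))
    (hρu : ∀ w : HeightOneSpectrum (𝓞 K), w ≠ vbar → ρ.IsUnramifiedAt w)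
    {Ω δ Ω' δ' : ℂ} {Ωp Ωp' : ℂ_[p]} {G G' U : PowerSeries (PowerSeries (PadicComplexInt p))}
    (hG : IsKatzMeasure₂ ι v vbar S κ₁ κ₂ γ₁ γ₂ lam Ω δ Ωp G)
    (hG' : IsKatzMeasure₂ ι v vbar S κ₁ κ₂ γ₁ γ₂ lam Ω' δ' Ωp' G')
    (hΩ : Ω ≠ 0) (hδ : δ ≠ 0) (hΩp : Ωp ≠ 0) (hΩ' : Ω' ≠ 0) (hδ' : δ' ≠ 0) (hΩp' : Ωp' ≠ 0)
    (hG0 : G ≠ 0) (hU : G' = U * G) :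
    IntSeries.HasValueAt₂ U
      (avatarValueAt ((FramedRep.unitsContinuousMulEquivOfUnique (Fin 1) (PadicAlgCl p) :
        (PadicAlgCl p)ˣ →ₜ* GL (Fin 1) (PadicAlgCl p)).comp ψρ) γ₁ - 1)
      (avatarValueAt ((FramedRep.unitsContinuousMulEquivOfUnique (Fin 1) (PadicAlgCl p) :
        (PadicAlgCl p)ˣ →ₜ* GL (Fin 1) (PadicAlgCl p)).comp ψρ) γ₂ - 1)
      (((((ι.symm (Ω / Ω')) : PadicAlgCl p) : ℂ_[p]) * (Ωp' / Ωp)) ^ ((jl - kl) + (βρ - αρ)) *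
        (((ι.symm (δ / δ')) : PadicAlgCl p) : ℂ_[p]) ^ (jl + βρ)) := by
  set eU := (FramedRep.unitsContinuousMulEquivOfUnique (Fin 1) (PadicAlgCl p) :
    (PadicAlgCl p)ˣ →ₜ* GL (Fin 1) (PadicAlgCl p)) with heU
  set A : ℂ_[p] := (((ι.symm (Ω / Ω')) : PadicAlgCl p) : ℂ_[p]) * (Ωp' / Ωp) with hAdef
  set B : ℂ_[p] := (((ι.symm (δ / δ')) : PadicAlgCl p) : ℂ_[p]) with hBdef
  have hιne : ∀ z : ℂ, z ≠ 0 → (((ι.symm z) : PadicAlgCl p) : ℂ_[p]) ≠ 0 := fun z hz ↦ by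
    rw [PadicComplex.coe_eq, map_ne_zero_iff _ (algebraMap (PadicAlgCl p) ℂ_[p]).injective,
      map_ne_zero_iff _ ι.symm.injective]
    exact hz
  have hA0 : A ≠ 0 := mul_ne_zero (hιne _ (div_ne_zero hΩ hΩ')) (div_ne_zero hΩp' hΩp)
  have hB0 : B ≠ 0 := hιne _ (div_ne_zero hδ hδ')
  -- ONE listing twist for the bound `|k| + |j| + |α| + |β|`
  set Bd : ℕ := kl.natAbs + jl.natAbs + (αρ.natAbs + βρ.natAbs) with hBd
  obtain ⟨η, ψ, n, hn, he, heκ, hηu, hηt⟩ := exists_listing_twist hK ι hpair Bd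
  -- the three listed types: `λη`, `λη²`, `λρη`
  obtain ⟨a₁, b₁, hba₁, ha₁, hb₁⟩ := exists_listed_type (k := kl) (j := jl) (B := Bd) (n := n) (by omega) hn
  obtain ⟨a₂, b₂, hba₂, ha₂, hb₂⟩ := exists_listed_type (k := kl) (j := jl) (B := Bd) (n := 2 * n) (by omega) (by omega)
  obtain ⟨a₃, b₃, hba₃, ha₃, hb₃⟩ := exists_listed_type (k := kl + αρ) (j := jl + βρ) (B := Bd) (n := n) (by omega) hn
  -- types of the twisted branches
  have htwist : ∀ (χ : HeckeCharacter K) (k' j' : ℤ) (a' b' : ℕ), χ.HasInfinityType (fun _ ↦ k') (fun _ ↦ j') →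
      (a' : ℤ) = ((2 * n : ℕ) : ℤ) - k' → (b' : ℤ) = j' + (n : ℤ) →
      (χ * η).HasInfinityType (fun _ ↦ -(a' : ℤ)) (fun _ ↦ (b' : ℤ)) := by
    intro χ k' j' a' b' hχ ha' hb'
    have h := hχ.mul' hηt
    have e1 : ((fun _ ↦ k' : InfinitePlace K → ℤ) + fun _ ↦ -((2 * n : ℕ) : ℤ)) = fun _ ↦ -(a' : ℤ) := by
      funext w'
      simp only [Pi.add_apply, ha']
      ring
    have e2 : ((fun _ ↦ j' : InfinitePlace K → ℤ) + fun _ ↦ (n : ℤ)) = fun _ ↦ (b' : ℤ) := by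
      funext w'
      simp only [Pi.add_apply, hb']
    exact Eq.mp (congrArg₂ (fun f g ↦ (χ * η).HasInfinityType f g) e1 e2) h
  have hlamη : (lam * η).HasInfinityType (fun _ ↦ -(a₁ : ℤ)) (fun _ ↦ (b₁ : ℤ)) := htwist lam kl jl a₁ b₁ hlam ha₁ hb₁
  have hlamη_t : (lam * η).HasInfinityType (fun _ ↦ kl - ((2 * n : ℕ) : ℤ)) (fun _ ↦ jl + (n : ℤ)) := by
    have e1 : (fun _ ↦ -(a₁ : ℤ) : InfinitePlace K → ℤ) = fun _ ↦ kl - ((2 * n : ℕ) : ℤ) := by funext w'; rw [ha₁]; ring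
    have e2 : (fun _ ↦ (b₁ : ℤ) : InfinitePlace K → ℤ) = fun _ ↦ jl + (n : ℤ) := by funext w'; rw [hb₁]
    exact Eq.mp (congrArg₂ (fun f g ↦ (lam * η).HasInfinityType f g) e1 e2) hlamη
  have hlamηη : (lam * (η * η)).HasInfinityType (fun _ ↦ -(a₂ : ℤ)) (fun _ ↦ (b₂ : ℤ)) := by
    rw [← mul_assoc]
    refine htwist (lam * η) _ _ a₂ b₂ hlamη_t ?_ ?_
    · rw [ha₂]; push_cast; ring
    · rw [hb₂]; push_cast; ring
  have hlamρ : (lam * ρ).HasInfinityType (fun _ ↦ kl + αρ) (fun _ ↦ jl + βρ) := by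
    have h := hlam.mul' hρt
    exact h
  have hlamρη : (lam * (ρ * η)).HasInfinityType (fun _ ↦ -(a₃ : ℤ)) (fun _ ↦ (b₃ : ℤ)) := by
    rw [← mul_assoc]; exact htwist (lam * ρ) _ _ a₃ b₃ hlamρ ha₃ hb₃
  -- avatars and ramification of `η²` and `ρη`
  have hηp : ∀ w : HeightOneSpectrum (𝓞 K), ((p : ℕ) : 𝓞 K) ∉ w.asIdeal → η.IsUnramifiedAt w := fun w _ ↦ hηu w
  have hρp : ∀ w : HeightOneSpectrum (𝓞 K), ((p : ℕ) : 𝓞 K) ∉ w.asIdeal → ρ.IsUnramifiedAt w :=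
    fun w hw ↦ hρu w (fun h ↦ hw (h ▸ hvbar))
  have heηη : IsPAdicAvatarOf ι (η * η) (eU.comp (ψ * ψ)) := isPAdicAvatarOf_mul ι he he (hram_of_forall hηp hηp)
  have heρη : IsPAdicAvatarOf ι (ρ * η) (eU.comp (ψρ * ψ)) := isPAdicAvatarOf_mul ι heρ he (hram_of_forall hρp hηp)
  have hpairmul : ∀ {χ χ' : absoluteGaloisGroup K →ₜ* (PadicAlgCl p)ˣ}, FactorsThroughPair κ₁ κ₂ (eU.comp χ) →
      FactorsThroughPair κ₁ κ₂ (eU.comp χ') → FactorsThroughPair κ₁ κ₂ (eU.comp (χ * χ')) := by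
    intro χ χ' hχ hχ' σ hσ₁ hσ₂
    have hA := hχ σ hσ₁ hσ₂
    have hB := hχ' σ hσ₁ hσ₂
    rw [ContinuousMonoidHom.coe_comp, Function.comp_apply] at hA hB ⊢
    rw [ContinuousMonoidHom.mul_apply, map_mul, hA, hB, mul_one]
  have heηηκ : FactorsThroughPair κ₁ κ₂ (eU.comp (ψ * ψ)) := hpairmul heκ heκ
  have heρηκ : FactorsThroughPair κ₁ κ₂ (eU.comp (ψρ * ψ)) := hpairmul hρκ heκ
  have hηηu : ∀ w : HeightOneSpectrum (𝓞 K), w ≠ vbar → (η * η).IsUnramifiedAt w := fun w _ ↦ (hηu w).mul' (hηu w)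
  have hρηu : ∀ w : HeightOneSpectrum (𝓞 K), w ≠ vbar → (ρ * η).IsUnramifiedAt w := fun w hw ↦ (hρu w hw).mul' (hηu w)
  -- §2 at the three twists
  have hY₁ := hasValueAt₂_rigidityUnit_at_listing_twist hK hv hvbar hne hι hlamu hpair he heκ (fun w _ ↦ hηu w)
    hba₁ hlamη hG hG' hΩ hδ hΩp hΩ' hδ' hΩp' hG0 hU
  have hY₂ := hasValueAt₂_rigidityUnit_at_listing_twist hK hv hvbar hne hι hlamu hpair heηη heηηκ hηηu
    hba₂ hlamηη hG hG' hΩ hδ hΩp hΩ' hδ' hΩp' hG0 hU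
  have hY₃ := hasValueAt₂_rigidityUnit_at_listing_twist hK hv hvbar hne hι hlamu hpair heρη heρηκ hρηu
    hba₃ hlamρη hG hG' hΩ hδ hΩp hΩ' hδ' hΩp' hG0 hU
  -- the explicit shape of `U` (file 3 at `η`) and its values
  obtain ⟨c₀, x, w, s₁, s₂, hs₁, hs₂, -, -, -, -, hEq⟩ := exists_eq_unitTwist₂_mul_of_listing_twist hK hv hvbar
    hne hι hlamu hpair he heκ (fun w _ ↦ hηu w) hba₁ hlamη hG hG' hΩ hδ hΩp hΩ' hδ' hΩp' hG0
  have hUeq : U = IntSeries.unitTwist₂ (PowerSeries.C (PowerSeries.C c₀) *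
      (PowerSeries.map (PowerSeries.C (R := PadicComplexInt p)) (IntSeries.binomPow x) *
        PowerSeries.C (IntSeries.binomPow w))) s₁ s₂ :=
    mul_right_cancel₀ hG0 (hU.symm.trans hEq)
  have V : ∀ {X Y : ℂ_[p]}, ‖X‖ < 1 → ‖Y‖ < 1 → IntSeries.HasValueAt₂ U X Y
      ((c₀ : ℂ_[p]) * (IntSeries.onePlusPow x ((s₁ : ℂ_[p]) * (1 + X) - 1) *
        IntSeries.onePlusPow w ((s₂ : ℂ_[p]) * (1 + Y) - 1))) := by
    intro X Y hX hY
    rw [hUeq]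
    exact hasValueAt₂_twistedUnit hs₁ hs₂ hX hY
  -- points
  set tη₁ := avatarValueAt (eU.comp ψ) γ₁ with htη₁
  set tη₂ := avatarValueAt (eU.comp ψ) γ₂ with htη₂
  set tρ₁ := avatarValueAt (eU.comp ψρ) γ₁ with htρ₁
  set tρ₂ := avatarValueAt (eU.comp ψρ) γ₂ with htρ₂
  have hη₁ : ‖tη₁ - 1‖ < 1 := norm_avatarValueAt_sub_one_lt_of_factorsThroughPair heκ γ₁
  have hη₂ : ‖tη₂ - 1‖ < 1 := norm_avatarValueAt_sub_one_lt_of_factorsThroughPair heκ γ₂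
  have hρ₁ : ‖tρ₁ - 1‖ < 1 := norm_avatarValueAt_sub_one_lt_of_factorsThroughPair hρκ γ₁
  have hρ₂ : ‖tρ₂ - 1‖ < 1 := norm_avatarValueAt_sub_one_lt_of_factorsThroughPair hρκ γ₂
  have hηη₁ : avatarValueAt (eU.comp (ψ * ψ)) γ₁ = tη₁ * tη₁ := by rw [htη₁, heU, avatarValueAt_unitsChar_mul]
  have hηη₂ : avatarValueAt (eU.comp (ψ * ψ)) γ₂ = tη₂ * tη₂ := by rw [htη₂, heU, avatarValueAt_unitsChar_mul]
  have hρη₁ : avatarValueAt (eU.comp (ψρ * ψ)) γ₁ = tρ₁ * tη₁ := by rw [htρ₁, htη₁, heU, avatarValueAt_unitsChar_mul]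
  have hρη₂ : avatarValueAt (eU.comp (ψρ * ψ)) γ₂ = tρ₂ * tη₂ := by rw [htρ₂, htη₂, heU, avatarValueAt_unitsChar_mul]
  rw [hηη₁, hηη₂] at hY₂
  rw [hρη₁, hρη₂] at hY₃
  -- the values from the explicit shape
  have Vη := V hη₁ hη₂
  have Vηη := V (X := tη₁ * tη₁ - 1) (Y := tη₂ * tη₂ - 1) (norm_mul_sub_one_lt hη₁ hη₁) (norm_mul_sub_one_lt hη₂ hη₂)
  have Vρη := V (X := tρ₁ * tη₁ - 1) (Y := tρ₂ * tη₂ - 1) (norm_mul_sub_one_lt hρ₁ hη₁) (norm_mul_sub_one_lt hρ₂ hη₂)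
  have Vρ := V hρ₁ hρ₂
  simp only [add_sub_cancel] at Vη Vηη Vρη Vρ
  have eq1 := Vη.unique hY₁
  have eq2 := Vηη.unique hY₂
  have eq3 := Vρη.unique hY₃
  -- multiplicativity twice
  have hmulηη := twistedUnitValue_mul (c₀ := (c₀ : ℂ_[p])) (x := x) (w := w) hs₁ hs₂ hη₁ hη₂ hη₁ hη₂
  have hmulρη := twistedUnitValue_mul (c₀ := (c₀ : ℂ_[p])) (x := x) (w := w) hs₁ hs₂ hρ₁ hρ₂ hη₁ hη₂
  rw [mul_one, mul_one] at hmulηη hmulρη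
  rw [eq1, eq2] at hmulηη
  rw [eq1, eq3] at hmulρη
  -- abbreviate the three explicit values
  set E₁ : ℂ_[p] := A ^ (a₁ + b₁) * B ^ b₁ with hE₁
  set E₂ : ℂ_[p] := A ^ (a₂ + b₂) * B ^ b₂ with hE₂
  set E₃ : ℂ_[p] := A ^ (a₃ + b₃) * B ^ b₃ with hE₃
  set V0 : ℂ_[p] := (c₀ : ℂ_[p]) * (IntSeries.onePlusPow x ((s₁ : ℂ_[p]) - 1) * IntSeries.onePlusPow w ((s₂ : ℂ_[p]) - 1))
    with hV0
  set Vr : ℂ_[p] := (c₀ : ℂ_[p]) * (IntSeries.onePlusPow x ((s₁ : ℂ_[p]) * tρ₁ - 1) *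
    IntSeries.onePlusPow w ((s₂ : ℂ_[p]) * tρ₂ - 1)) with hVr
  -- `E₂ * V0 = E₁ * E₁` and `E₃ * V0 = Vr * E₁`
  have hE₁0 : E₁ ≠ 0 := mul_ne_zero (pow_ne_zero _ hA0) (pow_ne_zero _ hB0)
  have hE₂0 : E₂ ≠ 0 := mul_ne_zero (pow_ne_zero _ hA0) (pow_ne_zero _ hB0)
  have hV0 : V0 = E₁ * E₁ / E₂ := by
    rw [eq_div_iff hE₂0, mul_comm]; exact hmulηη
  have hVr' : Vr = E₃ * V0 / E₁ := by
    rw [eq_div_iff hE₁0]; exact hmulρη.symm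
  -- the target value
  have htarget : Vr = A ^ ((jl - kl) + (βρ - αρ)) * B ^ (jl + βρ) := by
    rw [hVr', hV0, hE₁, hE₂, hE₃]
    have hexpA : (((a₃ + b₃ : ℕ) : ℤ) + ((a₁ + b₁ : ℕ) : ℤ) + ((a₁ + b₁ : ℕ) : ℤ) - ((a₂ + b₂ : ℕ) : ℤ) - ((a₁ + b₁ : ℕ) : ℤ)) =
        (jl - kl) + (βρ - αρ) := by
      push_cast
      rw [ha₁, hb₁, ha₂, hb₂, ha₃, hb₃]
      push_cast
      ring
    have hexpB : (((b₃ : ℕ) : ℤ) + (b₁ : ℤ) + (b₁ : ℤ) - (b₂ : ℤ) - (b₁ : ℤ)) = jl + βρ := by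
      rw [hb₁, hb₂, hb₃]
      push_cast
      ring
    rw [← hexpA, ← hexpB]
    rw [zpow_sub₀ hA0, zpow_sub₀ hA0, zpow_add₀ hA0, zpow_add₀ hA0, zpow_sub₀ hB0, zpow_sub₀ hB0,
      zpow_add₀ hB0, zpow_add₀ hB0]
    simp only [zpow_natCast]
    field_simp
  rw [← htarget]
  exact Vρ

/-! ### §5 Unit norms of the period ratios for any integer type -/

/-- **`‖A‖ = ‖B‖ = 1` for a branch of ANY integer type** (`A = ι⁻¹(Ω/Ω')·Ω_p'/Ω_p`, `B = ι⁻¹(δ/δ')`; two frames `G ≠ 0`, `G'` of the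
branch at the two triples): the tree's `PrintCf2.KatzPeriodRigidity.norm_periodRatio_eq_one` run on the branch twisted by a listing twist.
[cite: deShalit1987, II.4.12 Remarks (iii)–(iv) (p. 66–67)] -/
theorem norm_periodRatio_eq_one_of_hasInfinityType (hK : IsImaginaryQuadratic K)
    {ι : PadicAlgCl p ≃+* ℂ} {v vbar : HeightOneSpectrum (𝓞 K)}
    (hv : ((p : ℕ) : 𝓞 K) ∈ v.asIdeal) (hvbar : ((p : ℕ) : 𝓞 K) ∈ vbar.asIdeal) (hne : vbar ≠ v)
    (hι : ∀ (w : InfinitePlace K) (d : 𝓞 K), d ∈ v.asIdeal ↔ ‖ι.symm (w.embedding (d : K))‖ < 1)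
    {S : Finset (HeightOneSpectrum (𝓞 K))} {lam : HeckeCharacter K} {kl jl : ℤ}
    (hlam : lam.HasInfinityType (fun _ ↦ kl) (fun _ ↦ jl))
    (hlamu : ∀ w : HeightOneSpectrum (𝓞 K), w ∉ S → w ≠ vbar → lam.IsUnramifiedAt w)
    {κ₁ κ₂ : ZpExtension K p} {γ₁ γ₂ : absoluteGaloisGroup K}
    (hpair : ZpExtension.IsTopGeneratorPair κ₁ κ₂ γ₁ γ₂)
    {Ω δ Ω' δ' : ℂ} {Ωp Ωp' : ℂ_[p]} {G G' : PowerSeries (PowerSeries (PadicComplexInt p))}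
    (hG : IsKatzMeasure₂ ι v vbar S κ₁ κ₂ γ₁ γ₂ lam Ω δ Ωp G)
    (hG' : IsKatzMeasure₂ ι v vbar S κ₁ κ₂ γ₁ γ₂ lam Ω' δ' Ωp' G')
    (hΩ : Ω ≠ 0) (hδ : δ ≠ 0) (hΩp : Ωp ≠ 0) (hΩ' : Ω' ≠ 0) (hδ' : δ' ≠ 0) (hΩp' : Ωp' ≠ 0)
    (hG0 : G ≠ 0) :
    ‖(((ι.symm (Ω / Ω')) : PadicAlgCl p) : ℂ_[p]) * (Ωp' / Ωp)‖ = 1 ∧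
      ‖(((ι.symm (δ / δ')) : PadicAlgCl p) : ℂ_[p])‖ = 1 := by
  haveI : IsTotallyComplex K := hK.2
  set eU := (FramedRep.unitsContinuousMulEquivOfUnique (Fin 1) (PadicAlgCl p) :
    (PadicAlgCl p)ˣ →ₜ* GL (Fin 1) (PadicAlgCl p)) with heU
  obtain ⟨w₀, η₀, hw₀, hη₀, -⟩ :=
    Literature.NumberTheory.GaloisRepresentations.HeckeCharacter.exists_hasInfinityType_pos_zero_unramified
      (K := K) hK.1
  obtain ⟨η, ψ, n, hn, he, heκ, hηu, hηt⟩ := exists_listing_twist hK ι hpair (kl.natAbs + jl.natAbs)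
  obtain ⟨a, b, hba, ha, hb⟩ := exists_listed_type (le_refl (kl.natAbs + jl.natAbs)) hn
  have hlamη : (lam * η).HasInfinityType (fun _ ↦ -(a : ℤ)) (fun _ ↦ (b : ℤ)) := by
    have h := hlam.mul' hηt
    have e1 : ((fun _ ↦ kl : InfinitePlace K → ℤ) + fun _ ↦ -((2 * n : ℕ) : ℤ)) = fun _ ↦ -(a : ℤ) := by
      funext w'
      simp only [Pi.add_apply, ha]
      ring
    have e2 : ((fun _ ↦ jl : InfinitePlace K → ℤ) + fun _ ↦ (n : ℤ)) = fun _ ↦ (b : ℤ) := by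
      funext w'
      simp only [Pi.add_apply, hb]
    exact Eq.mp (congrArg₂ (fun f g ↦ (lam * η).HasInfinityType f g) e1 e2) h
  have hlamηu : ∀ w : HeightOneSpectrum (𝓞 K), w ∉ S → w ≠ vbar → (lam * η).IsUnramifiedAt w :=
    fun w hw hwv ↦ (hlamu w hw hwv).mul' (hηu w)
  set t₁ : PadicComplexInt p := ⟨avatarValueAt (eU.comp ψ) γ₁, avatarValueAt_mem_padicComplexInt _ _⟩ with ht₁def
  set t₂ : PadicComplexInt p := ⟨avatarValueAt (eU.comp ψ) γ₂, avatarValueAt_mem_padicComplexInt _ _⟩ with ht₂def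
  have ht₁ : ‖(t₁ : ℂ_[p]) - 1‖ < 1 := norm_avatarValueAt_sub_one_lt_of_factorsThroughPair heκ γ₁
  have ht₂ : ‖(t₂ : ℂ_[p]) - 1‖ < 1 := norm_avatarValueAt_sub_one_lt_of_factorsThroughPair heκ γ₂
  have hηp : ∀ w : HeightOneSpectrum (𝓞 K), ((p : ℕ) : 𝓞 K) ∉ w.asIdeal → η.IsUnramifiedAt w := fun w _ ↦ hηu w
  have hTw : IsKatzMeasure₂ ι v vbar S κ₁ κ₂ γ₁ γ₂ (lam * η) Ω δ Ωp (IntSeries.unitTwist₂ G t₁ t₂) :=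
    hG.unitTwist₂_of_avatar he heκ hηp
  have hTw' : IsKatzMeasure₂ ι v vbar S κ₁ κ₂ γ₁ γ₂ (lam * η) Ω' δ' Ωp' (IntSeries.unitTwist₂ G' t₁ t₂) :=
    hG'.unitTwist₂_of_avatar he heκ hηp
  have hTw0 : IntSeries.unitTwist₂ G t₁ t₂ ≠ 0 := by
    intro h0
    apply hG0
    refine IntSeries.eq_of_unitTwist₂_eq ht₁ ht₂ ?_
    rw [h0, ← IntSeries.unitTwist₂RingHom_apply t₁ t₂ ht₁ ht₂, map_zero]
  exact PrintCf2.KatzPeriodRigidity.norm_periodRatio_eq_one hK hv hvbar hne hι hw₀ hη₀ hba hlamη hlamηu hpair hTw hTw'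
    hΩ hδ hΩp hΩ' hδ' hΩp' hTw0

/-! ### §6 Transport of the REFLECTED frame along the period axis, on the genuine interpolation pairs -/

/-- **TRANSPORT OF THE `λ̌`-FRAME TO A SECOND PERIOD TRIPLE (on every interpolation pair whose character is unramified off `v̄`).**
`K` imaginary quadratic, `p = v v̄` any split prime, `λ` of type `(k, j)` unramified at every `w ∉ S` (so `λ̌ = reflect λ` is a branch
character at `c • S`), topological pair.  Let `G ≠ 0`, `G'` be `λ`-frames at `(Ω, δ, Ω_p)`, `(Ω', δ', Ω_p')` (six non-zero period
quantities), `U` the unit with `G' = U·G`, and `Ǧ` a `λ̌`-frame at `(Ω, δ, Ω_p)`.  Then there is a constant `κ₀ ∈ 𝒪_{ℂ_p}` of norm one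
(`κ₀ = B^{−(k+j+1)}`) such that `Ǧ' := C(C κ₀)·U·Ǧ` satisfies the interpolation property of the `λ̌`-FRAME AT `(Ω', δ', Ω_p')` at EVERY
interpolation pair `(ρ', r')` of that frame whose character `ρ'` is unramified at every `w ≠ v̄` — which every GENUINE pair is (an
avatar through the `ℤ_p²`-tower is unramified away from `p`); the weak predicate `IsPAdicAvatarOf` does not record this, so the
hypothesis is displayed.  Proof: `Ǧ(P r')` is the old value; the new value is `A^{m'+j'}B^{j'}` times it
(`padicValue_eq_periodRatio_pow_mul`); `U(P r') = A^{(j−k)+(β'−α')}B^{j+β'}` (§4) with `(α', β') = type ρ' = (j+1−m', k+1+j')`, i.e.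
`A^{m'+j'}B^{j'+k+j+1}`; `κ₀` absorbs `B^{k+j+1}`.  This is the EXISTENCE half of what the typed
`DeShalit1987.thmII64_katzMeasure₂_functionalEquation` claims at a non-admissible period triple, reduced to the genuineness of interpolation pairs.
[cite: deShalit1987, II.4.12 Remarks (iii)–(iv) (p. 66–67), II.4.16 (49)–(50), II.4.17 (51)–(54) (store chunk 77–78), II.6.1 (1), II.6.4 (store chunk 84–85)] -/
theorem reflectFrame_transport_on_unramified [IsCMField K] (hK : IsImaginaryQuadratic K)
    {ι : PadicAlgCl p ≃+* ℂ} {v vbar : HeightOneSpectrum (𝓞 K)}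
    (hv : ((p : ℕ) : 𝓞 K) ∈ v.asIdeal) (hvbar : ((p : ℕ) : 𝓞 K) ∈ vbar.asIdeal) (hne : vbar ≠ v)
    (hι : ∀ (w : InfinitePlace K) (d : 𝓞 K), d ∈ v.asIdeal ↔ ‖ι.symm (w.embedding (d : K))‖ < 1)
    {S : Finset (HeightOneSpectrum (𝓞 K))} {lam : HeckeCharacter K} {kl jl : ℤ}
    (hlam : lam.HasInfinityType (fun _ ↦ kl) (fun _ ↦ jl))
    (hlamu : ∀ w : HeightOneSpectrum (𝓞 K), w ∉ S → w ≠ vbar → lam.IsUnramifiedAt w)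
    {κ₁ κ₂ : ZpExtension K p} {γ₁ γ₂ : absoluteGaloisGroup K}
    (hpair : ZpExtension.IsTopGeneratorPair κ₁ κ₂ γ₁ γ₂)
    {Ω δ Ω' δ' : ℂ} {Ωp Ωp' : ℂ_[p]} {G G' U Gc : PowerSeries (PowerSeries (PadicComplexInt p))}
    (hG : IsKatzMeasure₂ ι v vbar S κ₁ κ₂ γ₁ γ₂ lam Ω δ Ωp G)
    (hG' : IsKatzMeasure₂ ι v vbar S κ₁ κ₂ γ₁ γ₂ lam Ω' δ' Ωp' G')
    (hΩ : Ω ≠ 0) (hδ : δ ≠ 0) (hΩp : Ωp ≠ 0) (hΩ' : Ω' ≠ 0) (hδ' : δ' ≠ 0) (hΩp' : Ωp' ≠ 0)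
    (hG0 : G ≠ 0) (hU : G' = U * G)
    (hGc : IsKatzMeasure₂ ι v vbar (S.image fun w ↦ IsCMField.complexConj K • w) κ₁ κ₂ γ₁ γ₂
      (reflect lam) Ω δ Ωp Gc) :
    ∃ κ₀ : PadicComplexInt p, ‖(κ₀ : ℂ_[p])‖ = 1 ∧
      ∀ (ρ' : HeckeCharacter K) (r' : FramedGaloisRep K (PadicAlgCl p) 1) (m' j' : ℕ),
        IsPAdicAvatarOf ι ρ' r' → FactorsThroughPair κ₁ κ₂ r' → j' < m' →
        (reflect lam * ρ').HasInfinityType (fun _ ↦ -(m' : ℤ)) (fun _ ↦ (j' : ℤ)) →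
        (∀ w : HeightOneSpectrum (𝓞 K), w ∉ (S.image fun w ↦ IsCMField.complexConj K • w) → w ≠ vbar →
          (reflect lam * ρ').IsUnramifiedAt w) →
        (∀ w : HeightOneSpectrum (𝓞 K), w ≠ vbar → ρ'.IsUnramifiedAt w) →
        ∀ hL : LFunction.HasEntireContinuation (heckeLFunction (reflect lam * ρ')),
          IntSeries.HasValueAt₂ (PowerSeries.C (PowerSeries.C κ₀) * U * Gc)
            (avatarValueAt r' γ₁ - 1) (avatarValueAt r' γ₂ - 1)
            (((ι.symm (DeShalit1987.interpolationValue p v vbar (S.image fun w ↦ IsCMField.complexConj K • w)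
                (reflect lam * ρ') m' j' Ω' δ' (hL.continuation 0)) : PadicAlgCl p) : ℂ_[p]) * Ωp' ^ (m' + j')) := by
  set eU := (FramedRep.unitsContinuousMulEquivOfUnique (Fin 1) (PadicAlgCl p) :
    (PadicAlgCl p)ˣ →ₜ* GL (Fin 1) (PadicAlgCl p)) with heU
  obtain ⟨hAn, hBn⟩ := norm_periodRatio_eq_one_of_hasInfinityType hK hv hvbar hne hι hlam hlamu hpair hG hG' hΩ hδ hΩp
    hΩ' hδ' hΩp' hG0
  have hB0 : (((ι.symm (δ / δ')) : PadicAlgCl p) : ℂ_[p]) ≠ 0 := fun h ↦ by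
    rw [h, norm_zero] at hBn
    exact zero_ne_one hBn
  -- the constant `κ₀ = B^{-(k+j+1)}`
  set κc : ℂ_[p] := (((ι.symm (δ / δ')) : PadicAlgCl p) : ℂ_[p]) ^ (-(kl + jl + 1)) with hκc
  have hκn : ‖κc‖ = 1 := by rw [hκc, norm_zpow, hBn, one_zpow]
  set κ₀ : PadicComplexInt p := ⟨κc, mem_padicComplexInt_iff.mpr hκn.le⟩ with hκ₀def
  have hcoe : (κ₀ : ℂ_[p]) = κc := rfl
  refine ⟨κ₀, hκn, ?_⟩
  intro ρ' r' m' j' hr' hκ' hjm hinf hunr hρu hL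
  -- the avatar in unit-valued form
  obtain ⟨ψ', hψ'⟩ := PrintCf2.GoodTwistDictPairSigns.exists_unitsChar_eq r'
  rw [hψ'] at hr' hκ'
  -- the type of `ρ'`: `(j + 1 - m', k + 1 + j')`
  have hlt := hasInfinityType_reflect hlam
  have hρt : ρ'.HasInfinityType (fun _ ↦ jl + 1 - (m' : ℤ)) (fun _ ↦ kl + 1 + (j' : ℤ)) := by
    have h := hlt.inv.mul' hinf
    rw [inv_mul_cancel_left] at h
    have e1 : (-(fun w : InfinitePlace K ↦ -(fun _ : InfinitePlace K ↦ jl) w - 1) + fun _ ↦ -(m' : ℤ)) =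
        fun _ ↦ jl + 1 - (m' : ℤ) := by
      funext w'; simp only [Pi.add_apply, Pi.neg_apply]; ring
    have e2 : (-(fun w : InfinitePlace K ↦ -(fun _ : InfinitePlace K ↦ kl) w - 1) + fun _ ↦ (j' : ℤ)) =
        fun _ ↦ kl + 1 + (j' : ℤ) := by
      funext w'; simp only [Pi.add_apply, Pi.neg_apply]; ring
    exact Eq.mp (congrArg₂ (fun f g ↦ ρ'.HasInfinityType f g) e1 e2) h
  -- §4: the value of `U` at the point of `ρ'`
  have hUval := hasValueAt₂_rigidityUnit_at_algebraic hK hv hvbar hne hι hlam hlamu hpair hρt hr' hκ' hρu hG hG' hΩ hδ hΩp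
    hΩ' hδ' hΩp' hG0 hU
  -- the old value of `Ǧ` at the same pair
  have hGcval := hGc ρ' (eU.comp ψ') m' j' hr' hκ' hjm hinf hunr hL
  -- the new value = `A^{m'+j'} B^{j'}` × the old one
  have hnew := PrintCf2.KatzPeriodRigidity.padicValue_eq_periodRatio_pow_mul ι v vbar
    (S.image fun w ↦ IsCMField.complexConj K • w) (reflect lam * ρ') m' j' Ω' δ' (hL.continuation 0) Ωp' hΩ hδ hΩp
  -- assemble the product
  have hX : ‖avatarValueAt (eU.comp ψ') γ₁ - 1‖ < 1 := norm_avatarValueAt_sub_one_lt_of_factorsThroughPair hκ' γ₁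
  have hY : ‖avatarValueAt (eU.comp ψ') γ₂ - 1‖ < 1 := norm_avatarValueAt_sub_one_lt_of_factorsThroughPair hκ' γ₂
  have hprod := PrintCf2.RubinValueTwoReadout.hasValueAt₂_mul hX hY
    (PrintCf2.RubinValueTwoReadout.hasValueAt₂_mul hX hY (hasValueAt₂_C (IntSeries.hasValueAt_C κ₀ _)) hUval) hGcval
  rw [hψ', hnew]
  convert hprod using 1
  -- the scalar identity `A^{m'+j'} B^{j'} · old = κ₀ · (A^{m'+j'} B^{(k+j+1)+j'}) · old`
  have eA : ((jl - kl) + ((kl + 1 + (j' : ℤ)) - (jl + 1 - (m' : ℤ)))) = ((m' + j' : ℕ) : ℤ) := by push_cast; ring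
  have eB : (jl + (kl + 1 + (j' : ℤ))) = (kl + jl + 1) + ((j' : ℕ) : ℤ) := by ring
  have key : ∀ (Aq Bq old κ : ℂ_[p]) (n₁ n₂ : ℕ) (e : ℤ), Bq ≠ 0 → κ = Bq ^ (-e) →
      Aq ^ n₁ * Bq ^ n₂ * old = κ * (Aq ^ n₁ * (Bq ^ e * Bq ^ n₂)) * old := by
    intro Aq Bq old κ n₁ n₂ e hBq hκ
    rw [hκ, zpow_neg]
    field_simp
  rw [eA, eB, zpow_natCast, zpow_add₀ hB0, zpow_natCast]
  exact key _ _ _ _ _ _ _ hB0 (hcoe.trans hκc)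

end Summit.BirchSwinnertonDyer.BirchSwinnertonDyer.Theorems.GoodLatticeKatzMeasureReflectTransport

end
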